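import Mathlib
import Summits.NavierStokesRegularity.NavierStokesRegularity.Theorems.FilamentSkeletonRssStadiumTangentModulus

/-!
# Route `FilamentSkeletonRss` · child crux `TangentSkeletonNearStraightL` (stmt-NavierStokesRegularity-23320) · registered line
# `child_tangent_analytic_strip_L` (b0b56c52900dd90a), stub `stub_stripPropagation` — brick: THE TANGENT MODULUS IN THE LOWER HALF OF THE STADIUM

`Theorems.StadiumTangentModulus.tangent_modulus_upper` (p817335) bounds `‖F′(z) − cplx(X′ cc)‖` on upper rectangles `Im z ∈ [0, H]`.  The stadium and all
hypotheses are symmetric under complex conjugation, and the reflected curve `F^♯ = star ∘ F ∘ conj` (Schwarz reflection; Mathlib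
`HasDerivAt.star_conj`) is again a stadium-analytic extension of the same real curve with `‖(F^♯)′‖ ≤ 2`; applying the upper bound to `F^♯` at `conj z`
gives the same bound on LOWER rectangles `Im z ∈ [−H, 0]` (`tangent_modulus_lower`), hence on the full closed rectangle `|Im z| ≤ H`
(`tangent_modulus_abs`).
HONEST FRAMING: a brick for a plan about a HYPOTHETICAL filament skeleton on the NEGATIVE side of a MODEL route; the stub `stub_stripPropagation` is NOT
closed; nothing here bears on Navier–Stokes regularity or blow-up.  `--supports stmt-NavierStokesRegularity-23320`.
-/

set_option linter.dupNamespace false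

noncomputable section

namespace Summit.NavierStokesRegularity.NavierStokesRegularity.Theorems.StadiumTangentModulusLower

open Set Filter Topology Complex
open scoped InnerProductSpace ComplexConjugate

/-- **Tangent modulus on a lower rectangle of the stadium** (reflection of `tangent_modulus_upper`). [folklore] -/
theorem tangent_modulus_lower {hs L cc Rb H ℓ δ : ℝ} (hhs : 0 < hs) (hRb : 0 < Rb) (hRb3 : Rb ≤ 3)
    (hH : 0 < H) (hHhs : H < hs) (hℓ : 0 < ℓ) (hℓ' : ℓ < L + hs) (hδ : 0 ≤ δ)
    {F : ℂ → (Fin 3 → ℂ)} (hF : DifferentiableOn ℂ F {z : ℂ | |z.im| < hs ∧ |z.re - cc| < L + hs})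
    (hFb : ∀ z ∈ {z : ℂ | |z.im| < hs ∧ |z.re - cc| < L + hs}, ‖deriv F z‖ ≤ 2)
    {X : ℝ → EuclideanSpace ℝ (Fin 3)} (hX : Differentiable ℝ X)
    (hFX : ∀ t : ℝ, (t : ℂ) ∈ {z : ℂ | |z.im| < hs ∧ |z.re - cc| < L + hs} →
      F t = fun i => ((⟪X t, EuclideanSpace.single i (1:ℝ)⟫_ℝ : ℝ) : ℂ))
    (hunit : ∀ t, ‖deriv X t‖ = 1) (hosc : ∀ τ σ, ‖deriv X τ - deriv X σ‖ ≤ Rb)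
    (hend : Real.log (3 / Rb) ≤ δ * Real.cosh (Real.pi / (2 * H) * ℓ)) :
    ∀ z : ℂ, |z.re - cc| ≤ ℓ → -H ≤ z.im → z.im ≤ 0 →
      ‖deriv F z - fun i => ((⟪deriv X cc, EuclideanSpace.single i (1:ℝ)⟫_ℝ : ℝ) : ℂ)‖ ≤
        Rb ^ (1 - (-z.im) / H) * 3 ^ ((-z.im) / H) *
          Real.exp (δ * (Real.cosh (Real.pi / (2 * H) * (z.re - cc)) * Real.cos (Real.pi / (2 * H) * (-z.im)))) := by
  set S : Set ℂ := {z : ℂ | |z.im| < hs ∧ |z.re - cc| < L + hs} with hSdef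
  set c0 : Fin 3 → ℂ := fun i => ((⟪deriv X cc, EuclideanSpace.single i (1:ℝ)⟫_ℝ : ℝ) : ℂ) with hc0
  have hSo : IsOpen S := by
    have h1 : IsOpen {z : ℂ | |z.im| < hs} := isOpen_lt (continuous_abs.comp Complex.continuous_im) continuous_const
    have h2 : IsOpen {z : ℂ | |z.re - cc| < L + hs} :=
      isOpen_lt (continuous_abs.comp (Complex.continuous_re.sub continuous_const)) continuous_const
    exact h1.inter h2
  have hSconj : ∀ w ∈ S, conj w ∈ S := fun w hw => by
    refine ⟨?_, ?_⟩
    · show |(conj w).im| < hs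
      rw [Complex.conj_im, abs_neg]; exact hw.1
    · show |(conj w).re - cc| < L + hs
      rw [Complex.conj_re]; exact hw.2
  -- the reflected curve
  set Fr : ℂ → (Fin 3 → ℂ) := star ∘ F ∘ conj with hFr
  have hFrd : ∀ w ∈ S, HasDerivAt Fr (star (deriv F (conj w))) w := by
    intro w hw
    have h1 : HasDerivAt F (deriv F (conj w)) (conj w) :=
      (hF.differentiableAt (hSo.mem_nhds (hSconj w hw))).hasDerivAt
    have h2 := h1.star_conj
    rw [Complex.conj_conj] at h2
    exact h2
  have hFrD : DifferentiableOn ℂ Fr S := fun w hw => (hFrd w hw).differentiableAt.differentiableWithinAt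
  have hFrb : ∀ w ∈ S, ‖deriv Fr w‖ ≤ 2 := by
    intro w hw
    rw [(hFrd w hw).deriv, norm_star]
    exact hFb _ (hSconj w hw)
  have hFrX : ∀ t : ℝ, (t : ℂ) ∈ S → Fr t = fun i => ((⟪X t, EuclideanSpace.single i (1:ℝ)⟫_ℝ : ℝ) : ℂ) := by
    intro t ht
    have h1 : Fr t = star (F (conj (t : ℂ))) := rfl
    rw [h1, Complex.conj_ofReal, hFX t ht]
    funext i
    simp [Pi.star_apply, Complex.conj_ofReal]
  -- apply the upper bound to the reflected curve at `conj z`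
  have hup := Summit.NavierStokesRegularity.NavierStokesRegularity.Theorems.StadiumTangentModulus.tangent_modulus_upper
    hhs hRb hRb3 hH hHhs hℓ hℓ' hδ hFrD hFrb hX hFrX hunit hosc hend
  intro z hzre hzim1 hzim2
  have h := hup (conj z) (by rw [Complex.conj_re]; exact hzre) (by rw [Complex.conj_im]; linarith) (by rw [Complex.conj_im]; linarith)
  rw [Complex.conj_re, Complex.conj_im] at h
  -- `deriv Fr (conj z) = star (deriv F z)` when `z ∈ S`; if `z ∉ S` we still have the identity through `hFrd`? Need `z ∈ S`:
  have hzS : z ∈ S := by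
    refine ⟨?_, ?_⟩
    · show |z.im| < hs
      rw [abs_lt]; constructor <;> linarith
    · show |z.re - cc| < L + hs
      exact lt_of_le_of_lt hzre hℓ'
  have hconjS : conj z ∈ S := hSconj z hzS
  have hd : deriv Fr (conj z) = star (deriv F z) := by
    rw [(hFrd (conj z) hconjS).deriv, Complex.conj_conj]
  rw [hd] at h
  have hc0real : star c0 = c0 := by
    funext i; simp [hc0, Pi.star_apply, Complex.conj_ofReal]
  have hnorm : ‖star (deriv F z) - c0‖ = ‖deriv F z - c0‖ := by
    calc ‖star (deriv F z) - c0‖ = ‖star (deriv F z) - star c0‖ := by rw [hc0real]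
      _ = ‖star (deriv F z - c0)‖ := by rw [star_sub]
      _ = ‖deriv F z - c0‖ := norm_star _
  rw [hnorm] at h
  exact h

end Summit.NavierStokesRegularity.NavierStokesRegularity.Theorems.StadiumTangentModulusLower

end
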